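import Summits.Langlands.Langlands.Theses.CMFreeCompletedClosure
import Summits.Langlands.Langlands.Theorems.IrreducibilityBySelfDualityReciprocityUpToIrreducibilityCorrespondsConj
import Summits.Langlands.Langlands.Theorems.TemperedPurity.Negative.FalseWithoutGlobal
import HarnessLib

/-!
# Birth skeleton (BC3) for the crux `TemperedPurity` (item stmt-Langlands-18475) of route
`CMFreeCompletedClosure` — published as `Cruxes/TemperedPurity/Lines/birth.lean`
(skeleton registrar `planner-skel-stmt-Langlands-18475-0`, 2026-08-17; route re-audit bin HONEST).

**The crux** (route decl `Summit.Langlands.Langlands.Theses.CMFreeCompletedClosure.TemperedPurity`,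
card item C6 + uniqueness): for `E` totally complex, `n ≥ 1`, every reciprocity datum `R`, every
L-algebraic cuspidal `π` of `GL_n(𝔸_E)`, `(ℓ, ι)` and every IRREDUCIBLE framed `ρ : Γ_E → GL_n(ℚ̄_ℓ)`
Satake–Frobenius compatible with `π` a.e. which at EVERY finite `v` satisfies local–global
compatibility UP TO SEMISIMPLIFICATION (there are the local component `π_v`, `r = WD(ρ|_{W_{E_v}})`
— Grothendieck–Deligne at `v ∤ ℓ`, Fontaine `D_pst` at `v ∣ ℓ` —, its transport `rℂ = ι r`, and a
Frobenius-semisimple `r₀` in the class `rec_v(π_v)` with the same characteristic polynomials on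
`W_{E_v}` as `rℂ`): then FULL `LocalGlobalCompatibleAt R ι π ρ v` at every `v` (the monodromy
operators agree too) and every `ρ'` corresponding to `π` is conjugate to `ρ`.

**Disproof used.** `Theorems/TemperedPurity/Negative/FalseWithoutGlobal.lean` (refuter, p171180):
`temperedPurity_false_without_global` — the LOCAL form of the monodromy step ("same Weil-group
characteristic polynomials ⇒ `rℂ^{F-ss}` has the class of `r₀`") is FALSE, witness `St(0)` versus
`St(1)` on `ℂ²`.  Hence any proof must use the global origin of BOTH sides.  This skeleton honours it
exactly as Taylor–Yoshida do: the local rigidity stub (`stub_pureRigidity`) carries PURITY hypotheses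
on both Weil–Deligne representations — `St(0) = ‖·‖ ⊕ 1` with `N = 0` is mixed but not pure of any
weight, so the witness is excluded —, and the two purity inputs are the global stubs: purity of
`rec_v(π_v)` from cuspidality of `π` (temperedness, `stub_automorphicPurity`) and purity of
`ι WD(ρ|_{W_{E_v}})` from `ρ` being the irreducible Galois avatar of `π` (weight–monodromy,
`stub_galoisPurity`).

**The split = the structure of Taylor–Yoshida's proof of Thm. 1.2** (arXiv:math/0412357, p. 5–6:
"In view of parts (3) and (4) of this lemma, theorem 1.2 will follow from the following two results"
= temperedness of `Π_v` [HT] + Thm. 1.5 purity of `WD(R_l(Π)|_{Gal(L̄_v/L_v)})`):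

* `stub_automorphicPurity` — RAMANUJAN-TYPE PURITY ON THE AUTOMORPHIC SIDE: for an L-algebraic
  cuspidal `π` of `GL_n(𝔸_E)` (`E` totally complex) and its local component `π_v`, every
  Frobenius-semisimple `r₀` in the class `rec_v(π_v)` is pure of some real weight (TY Lemma 1.4 (3):
  `rec(π)` is pure of some weight iff `π` is (essentially) tempered).  Known: `π` regular algebraic
  conjugate-self-dual over CM (Harris–Taylor 2001 Cor. VII.1.11 square-integrable case; Shin 2011,
  Caraiani 2012 Thm. 1.2 in general); OPEN otherwise (generalised Ramanujan).
* `stub_galoisPurity` — WEIGHT–MONODROMY FOR THE GALOIS AVATAR: for `ρ` irreducible and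
  Satake–Frobenius compatible a.e. with such a `π`, at every finite `v` the transport `ι WD(ρ|_{W_{E_v}})`
  is pure of some real weight (TY Thm. 1.5; Caraiani 2012 Thm. 1.1 (`ℓ ≠ p`) and Caraiani 2014
  (`ℓ = p`) in the Shimura-variety sector); OPEN off that sector (non-polarizable regular: Varma 2024
  only gets `N_Galois ≼ N_aut`; irregular `π`).
* `stub_pureRigidity` — PURE RIGIDITY (purely local, in print): two PURE complex Weil–Deligne
  representations of `W_F` with the same characteristic polynomials on `W_F`, the second
  Frobenius-semisimple, have `r^{F-ss} ≅ r₀` — TY Lemma 1.4 (1) (`r` pure iff `r^{F-ss}` pure) +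
  Brauer–Nesbitt on `W_F` + TY Lemma 1.4 (4) ("given `(V, r)` with `r` semisimple there is, up to
  equivalence, at most one `N` which makes `(V, r, N)` pure").  Size L (needs the existence of the
  Frobenius-semisimplification and the graded normal form `V = ⊕ N^j V(i)` of TY p. 6).
* `TemperedPurity_of` — the composition, kernel-checked, no `sorry`: part (a) per place `v` from the
  three stubs; part (b) (uniqueness up to conjugacy) is NOT a stub — it is the landed theorem
  `ReciprocityUpToIrreducibility.isConjugate_of_satakeFrobCompatibleAt` (Chebotarev + Brauer–Nesbitt +
  irreducibility transfer), invoked by name.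

Helper notions (this file, sorry-free, over accepted declarations only; the tree has no purity
vocabulary for Weil–Deligne representations): `weightSpace r φ w` = the sum of the generalised
eigenspaces of `r.ρ φ` for the eigenvalues `α` with `|α|² = q^w` (`ι`-weights, `w : ℝ`), and
`IsPure r k` = Taylor–Yoshida's "pure of weight `k`" read through `ι` (p. 5 ibid.): for a geometric
Frobenius lift `φ` (`deg φ = -1`, tree sign convention) the weight spaces of weights `k + ℤ` span, and
`N^i` maps the weight-`(k+i)` space bijectively onto the weight-`(k-i)` space for every `i : ℕ`
(the accepted relation `ρ(w) N = q^{deg w} N ρ(w)` makes `N` lower `ι`-weights by `2`).  Checked by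
hand on the barrier's family: `St(1)` is pure of weight `-1`, `St(0)` is pure of no weight, an
unramified character of absolute value `q^{k/2}` is pure of weight `k` exactly.

Barrier: `Literature.Barriers.Langlands.MonodromyNotClosedUnderPadicLimits` (N is not closed under
ℓ-adic limits) bites any attempt to get `stub_galoisPurity` for irregular `π` from congruences to
regular ones — purity is exactly what does not pass to the limit; the stub must be earned by a
realisation or a new rigidity, which is why it is the hardest stub.  Dead lines on this crux: none
recorded (`ledger crux ls`: no workfiles before this one).  The earlier birth evidence (type seat
f53dacf04e) split the crux as (LGC everywhere) + (uniqueness); the uniqueness half is a landed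
one-liner, so that split is the crux minus a lemma — replaced here by the TY structure.
-/

noncomputable section

set_option linter.dupNamespace false

namespace Summit.Langlands.Langlands.Cruxes.TemperedPurity.Birth

open scoped MatrixGroups Matrix Classical NumberField
open NumberField IsDedekindDomain Filter
open Literature.NumberTheory.Automorphic Literature.NumberTheory.GaloisRepresentations
open Literature.NumberTheory.GaloisRepresentations.IsNonarchimedeanLocalField
open Summit.Langlands

/-! ### `ι`-weights and purity of complex Weil–Deligne representations (Taylor–Yoshida, p. 5) -/

section Purity

variable {F : Type*} [Field F] [ValuativeRel F] [TopologicalSpace F] [IsNonarchimedeanLocalField F]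
  {V : Type*} [AddCommGroup V] [Module ℂ V]

/-- The **weight-`w` space** of `r` for the Frobenius lift `φ`: the sum of the generalised
eigenspaces of `r.ρ φ` for the eigenvalues `α` with `|α|² = q^w` (`q = residueFieldCard F`,
`w : ℝ`; for `V ≠ 0` finite-dimensional these spaces, over the finitely many `w` that occur, span `V`).
[cite: TaylorYoshida2007, §1 p. 5 "strictly pure of weight k"] -/
def weightSpace (r : WeilDeligneRep F ℂ V) (φ : WeilGroup F) (w : ℝ) : Submodule ℂ V :=
  ⨆ (α : ℂ) (_ : ‖α‖ ^ 2 = (residueFieldCard F : ℝ) ^ w), Module.End.maxGenEigenspace (r.ρ φ) α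

/-- **`r` is pure of weight `k`** (Taylor–Yoshida, read through a fixed `ι : ℚ̄_ℓ ≅ ℂ`): for some
geometric Frobenius lift `φ` (`deg φ = -1`; for some, equivalently every, lift) the weight spaces of
weights in `k + ℤ` span `V` ("mixed with all weights in `k + ℤ`"), and for every `i : ℕ` the power
`N^i` maps the weight-`(k+i)` space bijectively onto the weight-`(k-i)` space
(`N^i : gr^W_{k+i} ⥲ gr^W_{k-i}`; with the accepted relation `ρ(w) N = q^{deg w} N ρ(w)`, `N` lowers
weights by `2`).  A strictly pure `r` (one weight) is pure iff `N = 0`; `Sp_s(W)` for `W` strictly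
pure of weight `k` is pure of weight `k - (s - 1)`. [cite: TaylorYoshida2007, §1 p. 5 "pure of weight k"] -/
def IsPure (r : WeilDeligneRep F ℂ V) (k : ℝ) : Prop :=
  ∃ φ : WeilGroup F, WeilGroup.deg φ = -1 ∧
    (⨆ i : ℤ, weightSpace r φ (k + i)) = ⊤ ∧
    ∀ i : ℕ, Set.BijOn (⇑(r.N ^ i)) (weightSpace r φ (k + i) : Set V) (weightSpace r φ (k - i) : Set V)

end Purity

/-! ### The three stubs -/

/-- **stub A — AUTOMORPHIC PURITY (Ramanujan-type).**  For `E` totally complex, `n ≥ 1`, a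
reciprocity datum `R`, an L-algebraic cuspidal `π` of `GL_n(𝔸_E)`, a finite place `v`, the local
component `π_v` of `π` at `v` and any Frobenius-semisimple `r₀` in the class `rec_v(π_v)`
(`R.llc v`, Henniart-normalised): `r₀` is pure of some real weight.  Why plausibly true: `π_v` is a
local component of a cuspidal (unitary up to twist) representation, conjecturally tempered up to
twist (generalised Ramanujan), and "`rec(π)` is pure of some weight iff `π` is essentially tempered"
(TY Lemma 1.4 (3); the twist moves the weight, whence `∃ k : ℝ`).  Known for regular algebraic
conjugate-self-dual `π` over CM fields (Harris–Taylor VII.1.11; Shin 2011; Caraiani 2012 Thm. 1.2);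
OPEN in general.  Size: open-problem (XL in the known sector: vendoring temperedness + TY 1.4 (3)).
Leans on: `ReciprocityData.llc`, `LocalLanglandsDatum.recGL`, `HasLocalComponentAt`, `IsPure` (here).
[cite: TaylorYoshida2007, Lemma 1.4 (3)] [cite: Caraiani2012, Thm. 1.2] [cite: HarrisTaylorAMS2001, Cor. VII.1.11] -/
theorem stub_automorphicPurity : ∀ (E : Type) [Field E] [NumberField E], NumberField.IsTotallyComplex E → ∀ (n : ℕ), 0 < n → ∀ (R : Summit.Langlands.ReciprocityData E) (hcpt : Literature.NumberTheory.Automorphic.isCompact_glFiniteIntegralLevel n E) (π : Literature.NumberTheory.Automorphic.CuspidalAutomorphicRepData n E hcpt), π.1.IsLAlgebraic → ∀ (v : IsDedekindDomain.HeightOneSpectrum (NumberField.RingOfIntegers E)) (πv : Literature.NumberTheory.Automorphic.SmoothIrrep (Matrix.GeneralLinearGroup (Fin n) (v.adicCompletion E))) (r₀ : Literature.NumberTheory.GaloisRepresentations.WeilDeligneRep (v.adicCompletion E) ℂ (Fin n → ℂ)) (h₀ : r₀.IsFrobSemisimple), π.1.HasLocalComponentAt v πv.ρ → Quotient.mk (Literature.NumberTheory.Automorphic.frobSemisimpleWDSetoid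 (v.adicCompletion E) n) ⟨r₀, h₀⟩ = (R.llc v).recGL n (Literature.NumberTheory.Automorphic.IrrClass.mk πv) → ∃ k : ℝ, IsPure r₀ k := by
  sorry

/-- **stub G — GALOIS PURITY (weight–monodromy for the Galois avatar of `π`).**  For `E` totally
complex, `n ≥ 1`, `R`, an L-algebraic cuspidal `π`, `(ℓ, ι)` and an IRREDUCIBLE framed
`ρ : Γ_E → GL_n(ℚ̄_ℓ)` Satake–Frobenius compatible with `(π, ι)` at all but finitely many places: at
every finite `v`, every Weil–Deligne representation `r` attached to `ρ|_{Γ_{E_v}}` (Grothendieck–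
Deligne recipe at `v ∤ ℓ`, the pinned Fontaine datum `R.pst ℓ v` at `v ∣ ℓ`) has transport `rℂ = ι r`
pure of some real weight.  Why plausibly true: `ρ` is "`ρ_{π,ι}`" (Chebotarev + Brauer–Nesbitt), and
weight–monodromy for automorphic Galois representations is Taylor–Yoshida Thm. 1.5 / Caraiani 2012
Thm. 1.1 (`ℓ ≠ p`), Caraiani 2014 (`ℓ = p`) whenever `ρ` is realised in the cohomology of a Shimura
variety (RACSDC sector, via the Rapoport–Zink weight spectral sequence); OPEN off that sector —
non-polarizable regular `π` (Varma 2024: only `N_Galois ≼ N_aut`), irregular `π` (no realisation;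
the catalogued barrier `MonodromyNotClosedUnderPadicLimits` forbids importing purity along
congruences).  At the compatible unramified places it says the Satake parameters of `π_v` have equal
absolute values (Ramanujan there), consistent with stub A.  Size: open-problem (the hardest stub).
Leans on: `IsWeilDeligneOfLadic`, `PstWeilDeligneData.IsWeilDeligneOf`, `IsTransportAlong`, `IsPure`.
[cite: TaylorYoshida2007, Thm. 1.5] [cite: Caraiani2012, Thm. 1.1] [cite: Caraiani2014] [cite: VarmaFMS2024] -/
theorem stub_galoisPurity : ∀ (E : Type) [Field E] [NumberField E], NumberField.IsTotallyComplex E → ∀ (n : ℕ), 0 < n → ∀ (R : Summit.Langlands.ReciprocityData E) (hcpt : Literature.NumberTheory.Automorphic.isCompact_glFiniteIntegralLevel n E) (π : Literature.NumberTheory.Automorphic.CuspidalAutomorphicRepData n E hcpt), π.1.IsLAlgebraic → ∀ (ℓ : ℕ) [Fact ℓ.Prime] (ι : PadicAlgCl ℓ ≃+* ℂ) (ρ : Literature.NumberTheory.GaloisRepresentations.FramedGaloisRep E (PadicAlgCl ℓ) n), ρ.toGaloisRep.IsIrreducible → (∀ᶠ v : IsDedekindDomain.HeightOneSpectrum (NumberField.RingOfIntegers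 E) in Filter.cofinite, Summit.Langlands.SatakeFrobCompatibleAt ι π.1 ρ v) → ∀ (v : IsDedekindDomain.HeightOneSpectrum (NumberField.RingOfIntegers E)) (r : Literature.NumberTheory.GaloisRepresentations.WeilDeligneRep (v.adicCompletion E) (PadicAlgCl ℓ) (Fin n → PadicAlgCl ℓ)) (rℂ : Literature.NumberTheory.GaloisRepresentations.WeilDeligneRep (v.adicCompletion E) ℂ (Fin n → ℂ)), (((ℓ : ℕ) : NumberField.RingOfIntegers E) ∉ v.asIdeal → Literature.NumberTheory.GaloisRepresentations.IsWeilDeligneOfLadic (ρ.toLocal v).toWeilGroupHom r) → (∀ hv : ((ℓ : ℕ) : NumberField.RingOfIntegers E) ∈ v.asIdeal, (R.pst ℓ v hv).IsWeilDeligneOf (ρ.toLocal v) r) → r.IsTransportAlong (ι : PadicAlgCl ℓ →+* ℂ) rℂ → ∃ k : ℝ, IsPure rℂ k := by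
  sorry

/-- **stub R — PURE RIGIDITY (local; Taylor–Yoshida Lemma 1.4 (1) + (4) with Brauer–Nesbitt).**
Over any non-archimedean local field `F`: if `r` and `r₀` are complex `n`-dimensional Weil–Deligne
representations of `W_F`, both PURE (of some real weights), `r₀` Frobenius-semisimple, with the same
characteristic polynomials `det(X - ρ(w))` for every `w ∈ W_F`, then the Frobenius-semisimplification
of `r` is isomorphic to `r₀` (`r.HasFrobSemisimpleClass [r₀]`, monodromy included).  Proof in print:
`r^{F-ss}` exists and is pure with `r` (same `N`, same generalised eigenspaces: TY 1.4 (1)); its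
Weil-group representation is semisimple with the traces of `r₀.ρ`, hence isomorphic to `r₀.ρ`
(Brauer–Nesbitt in characteristic `0`; `W_F` acts through `ℤ ⋉ (finite)` on both); and a semisimple
`(V, ρ)` carries at most one `N` up to equivalence making it pure (TY 1.4 (4): `V = ⊕_i ⊕_{j ≤ i} N^j V(i)`
with `[V(i)] = [V_i] - [V_{i+2} ⊗ |Art⁻¹|]`), the weights being forced equal by the symmetry
`N^i : gr_{k+i} ⥲ gr_{k-i}`.  Why it is not the refuted local statement: without the purity
hypotheses it is `temperedPurity_false_without_global` (St(0) vs St(1)); St(0) is not pure.  Size: L.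
Leans on: `IsFrobSemisimplificationOf`, `HasFrobSemisimpleClass`, `frobSemisimpleWDSetoid`, Mathlib
Jordan–Chevalley (`Module.End.exists_isNilpotent_isSemisimple`), `IsPure` (here).
[cite: TaylorYoshida2007, Lemma 1.4 (1) and (4)] [cite: DeligneAntwerpII1973, §8] -/
theorem stub_pureRigidity : ∀ (F : Type) [Field F] [ValuativeRel F] [TopologicalSpace F] [IsNonarchimedeanLocalField F] (n : ℕ) (r r₀ : Literature.NumberTheory.GaloisRepresentations.WeilDeligneRep F ℂ (Fin n → ℂ)) (h₀ : r₀.IsFrobSemisimple) (k k₀ : ℝ), IsPure r k → IsPure r₀ k₀ → (∀ w : Literature.NumberTheory.GaloisRepresentations.WeilGroup F, (LinearMap.toMatrix' (r.ρ w)).charpoly = (LinearMap.toMatrix' (r₀.ρ w)).charpoly) → r.HasFrobSemisimpleClass (Quotient.mk (Literature.NumberTheory.Automorphic.frobSemisimpleWDSetoid F n) ⟨r₀, h₀⟩) := by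
  sorry

/-! ### The stub statements as named propositions (the composition's hypotheses, by name)

`_Goal` is internal on purpose: audits listing the file's declarations by short name find the `stub_*`
THEOREMS, while the skeleton check accepts the hypotheses of `TemperedPurity_of` by the stub names they
carry.  Each `_Goal.stub_x` is `type_of% @stub_x` — no text duplicated, no `sorry` inherited. -/

namespace _Goal

/-- The statement of `stub_automorphicPurity`, as a named `Prop` (literally its type). [folklore] -/
def stub_automorphicPurity : Prop :=
  type_of% @Summit.Langlands.Langlands.Cruxes.TemperedPurity.Birth.stub_automorphicPurity

/-- The statement of `stub_galoisPurity`, as a named `Prop` (literally its type). [folklore] -/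
def stub_galoisPurity : Prop :=
  type_of% @Summit.Langlands.Langlands.Cruxes.TemperedPurity.Birth.stub_galoisPurity

/-- The statement of `stub_pureRigidity`, as a named `Prop` (literally its type). [folklore] -/
def stub_pureRigidity : Prop :=
  type_of% @Summit.Langlands.Langlands.Cruxes.TemperedPurity.Birth.stub_pureRigidity

end _Goal

/-! ### The composition (kernel-checked, no `sorry`; concludes the route decl BY NAME) -/

/-- **`TemperedPurity` from its three stubs.**  Under the crux's binders, at each finite `v` take the
witnesses `π_v, r, rℂ, r₀` of semisimplified compatibility; stub G makes `rℂ` pure, stub A makes `r₀`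
pure, and stub R (at `F = E_v`) turns the equality of characteristic polynomials into
`rℂ.HasFrobSemisimpleClass [r₀] = rec_v(π_v)`, i.e. `LocalGlobalCompatibleAt R ι π ρ v` with the same
`π_v, r, rℂ`.  The uniqueness clause is the landed
`ReciprocityUpToIrreducibility.isConjugate_of_satakeFrobCompatibleAt` (irreducible `ρ` + a.e.
Satake–Frobenius compatibility of both `ρ` and `ρ'` with `π`).  Hypotheses are, by name, the statements
of `stub_automorphicPurity`, `stub_galoisPurity`, `stub_pureRigidity`; the conclusion is the route decl
`Summit.Langlands.Langlands.Theses.CMFreeCompletedClosure.TemperedPurity`.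
[cite: TaylorYoshida2007, Thm. 1.2 and its reduction on p. 6] -/
theorem TemperedPurity_of (hA : _Goal.stub_automorphicPurity) (hG : _Goal.stub_galoisPurity)
    (hR : _Goal.stub_pureRigidity) :
    Summit.Langlands.Langlands.Theses.CMFreeCompletedClosure.TemperedPurity := by
  unfold _Goal.stub_automorphicPurity at hA
  unfold _Goal.stub_galoisPurity at hG
  unfold _Goal.stub_pureRigidity at hR
  intro E _ _ hE n hn R hcpt π hπ ℓ _ ι ρ hirr hev hss
  refine ⟨fun v => ?_, fun ρ' h' => ?_⟩
  · obtain ⟨πv, r, rℂ, r₀, h₀, hloc, hlad, hpst, htr, hcls, hcp⟩ := hss v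
    obtain ⟨k, hk⟩ := hG E hE n hn R hcpt π hπ ℓ ι ρ hirr hev v r rℂ hlad hpst htr
    obtain ⟨k₀, hk₀⟩ := hA E hE n hn R hcpt π hπ v πv r₀ h₀ hloc hcls
    refine ⟨πv, r, rℂ, hloc, hlad, hpst, htr, ?_⟩
    rw [← hcls]
    exact hR (v.adicCompletion E) n rℂ r₀ h₀ k k₀ hk hk₀ hcp
  · exact Summit.Langlands.Langlands.Theorems.ReciprocityUpToIrreducibility.isConjugate_of_satakeFrobCompatibleAt
      π.1 ι hirr hev h'.1

/-- By-name sanity check: the stubs' own types feed `TemperedPurity_of` and the conclusion is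
literally the route decl. -/
example : Summit.Langlands.Langlands.Theses.CMFreeCompletedClosure.TemperedPurity :=
  TemperedPurity_of stub_automorphicPurity stub_galoisPurity stub_pureRigidity

end Summit.Langlands.Langlands.Cruxes.TemperedPurity.Birth

end
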